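import Summits.BirchSwinnertonDyer.BirchSwinnertonDyer.Theorems.AdditiveBranchIMCGordTwoRankZeroOffCaseOneFieldSupplyR0Partner
import Summits.BirchSwinnertonDyer.BirchSwinnertonDyer.Theorems.AdditiveKolyvaginRoadRamifiedHabitatTwistRowDefect
import Summits.BirchSwinnertonDyer.BirchSwinnertonDyer.Theorems.AdditiveBranchIMCGenusGrossZagierHeegnerOne
import Summits.BirchSwinnertonDyer.Rank1Residual.Additive.QuadraticTwistSurj
import Literature.NumberTheory.EllipticCurves.CaiShuTian2014.HeegnerConditionProofs
import Literature.NumberTheory.EllipticCurves.NonEisensteinPrimeOfSurjective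
import Literature.NumberTheory.EllipticCurves.LeadingTermBSZOrdinaryProofs
import HarnessLib

/-!
# Route `AdditiveBranchIMC` (rung K1), cruxes 19357 / 19358 / 19359, stub `stub_tameAwayFromCycR0` (skeleton v22):
# the GOOD-ORDINARY PARTNER `V` of a tame-sub-row curve carries the hypotheses of the printed two-variable
# divisibility (square-free level, big image, the Wan prime as a Steinberg prime with `ρ̄` ramified)

Cell `bsd-addord`, LEAD seat `cruxlead-19357` (gen 7), `Cruxes/GordTwoRankZeroOffCaseOne/LeadReport14.md` §5. THEOREMS ONLY
(no definition, no named fact, no `sorry`). The load-bearing registered stub of the tame lines is, since v22, the two-variable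
divisibility AWAY FROM THE CYCLOTOMIC VARIABLE (`TameAwayFromCycAt`), in print Castella–Liu–Wan, Forum Math. Sigma 10 (2022)
e110, Thm. 8.2.1 (1) for `(π_{f_V}, 𝒦, ξ)` with `E = V ⊗ χ_{p*}`. Its printed hypotheses bear on the PARTNER `V`: `π_{V,p}`
unramified (good reduction at `p`), `π_{V,v}` unramified or Steinberg at every finite `v` (square-free level `N_V`), a
non-split prime `q` at which `π_V` is ramified (Steinberg at `q`, `ρ̄` ramified at `q`: `p ∤ v_q(Δ_V)`), `ρ̄_V|_{G_𝒦}`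
irreducible (big image). This file DISCHARGES them from the line's binders (`N10.CellGordTwo`, the unfolded `TameRoadRow` —
`p ≥ 5`, `Surj W p`, `W` semistable outside `p`, a Wan prime `q` — and modularity), ONCE, for every consumer:

* `exists_partner_data` — `V` globally minimal with `C • V^{(p*)} = W`, `GoodOrd V p`, `N_W = N_V·p²`, `p ∤ N_V`,
  `Squarefree N_V`, `Surj V p`, `q ∣ N_V`, `V` multiplicative at `q`, `p ∤ v_q(Δ_min(V))`.

Everything is bookkeeping on tree theorems: the partner and `N_W = N_V p²` (`ThreeFieldRoadSupply.exists_goodOrd_partner_rootNumber`),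
`f_ℓ(E) ≤ 1` at good/multiplicative `ℓ` (`not_dvd_conductorNorm_of_hasGoodReductionAtPrime`,
`factorization_conductorNorm_eq_one_of_hasMultiplicativeReductionAtPrime`), big image through a twist
(`Additive.surj_iff_of_model_twist`), multiplicative type and `v_q(Δ_min)` through a twist unramified at `q`
(`hasMultiplicativeReductionAtPrime_quadraticTwist_iff_of_odd`, `AdditiveKoly.RamifiedHabitat.padicValInt_minimalDiscriminantInt_eq_of_twist_of_not_dvd`).

References: F. Castella, Z. Liu, X. Wan, Forum Math. Sigma 10 (2022) e110, §4.1 and Thm. 8.2.1; J. H. Silverman, *AEC* VII.5,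
*ATAEC* IV.10.2.
-/

set_option linter.dupNamespace false
set_option autoImplicit false

noncomputable section

open scoped Classical

open WeierstrassCurve NumberField
  Literature.NumberTheory.EllipticCurves Literature.NumberTheory.EllipticCurves.ModularForms
  Literature.NumberTheory.EllipticCurves.Rank1Residual
  Summit.BirchSwinnertonDyer.Rank1Residual Summit.BirchSwinnertonDyer.Rank1Residual.Additive

namespace Summit.BirchSwinnertonDyer.BirchSwinnertonDyer.Theorems.TamePartnerData

variable (W : WeierstrassCurve ℚ) [W.IsElliptic] [W.IsGloballyMinimal] (p : ℕ) [hp : Fact p.Prime]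

/-- **The good-ordinary partner of a tame-sub-row curve carries the printed hypotheses of the two-variable divisibility.**
For `(E, p)` on the cell (G-ord, `e = 2`) with `p ≥ 5`, `ρ̄_{E,p}` onto, `E` semistable outside `p` and a prime `q ≠ p`,
`q ≠ 2` of multiplicative reduction with `p ∤ v_q(Δ_min(E))` (the Wan prime), and modularity: there is a globally minimal
`V` with `C • V^{(p*)} = E`, good ordinary at `p`, `N_E = N_V·p²`, `p ∤ N_V`, `N_V` SQUARE-FREE, `ρ̄_{V,p}` onto, `q ∣ N_V`, `V`
multiplicative at `q` and `p ∤ v_q(Δ_min(V))`. [cite: CastellaLiuWan2022, §4.1 «Our setup» (arXiv:2109.08375)]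
[cite: SilvermanAEC2009, VII.5 Prop. 5.1; X.5 Cor. 5.4] [cite: Silverman1994, IV.10.2] -/
theorem exists_partner_data (hmod : exists_isNewformOf) (hp5 : 5 ≤ p) (hcell : N10.CellGordTwo W p) (hsurj : Surj W p)
    (hss : ∀ ℓ : ℕ, (hℓ : ℓ.Prime) → ℓ ≠ p →
      (haveI : Fact ℓ.Prime := ⟨hℓ⟩; W.HasGoodReductionAtPrime ℓ ∨ W.HasMultiplicativeReductionAtPrime ℓ))
    {q : ℕ} [hq : Fact q.Prime] (hqp : q ≠ p) (hq2 : q ≠ 2) (hmq : W.HasMultiplicativeReductionAtPrime q)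
    (hram : ¬ p ∣ padicValInt q W.minimalDiscriminantInt) :
    ∃ (V : WeierstrassCurve ℚ) (_ : V.IsElliptic) (_ : V.IsGloballyMinimal) (C : VariableChange ℚ),
      C • V.quadraticTwist ((-1 : ℚ) ^ (p / 2) * p) = W ∧ GoodOrd V p ∧
      W.conductorNorm ℤ = V.conductorNorm ℤ * p ^ 2 ∧ ¬ p ∣ V.conductorNorm ℤ ∧
      Squarefree (V.conductorNorm ℤ) ∧ Surj V p ∧ q ∣ V.conductorNorm ℤ ∧
      V.HasMultiplicativeReductionAtPrime q ∧ ¬ p ∣ padicValInt q V.minimalDiscriminantInt := by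
  have hpr : p.Prime := hp.out
  have hqr : q.Prime := hq.out
  have hp2 : p ≠ 2 := by omega
  obtain ⟨V, iV, iVm, CV, -, hord, ⟨C, hC⟩, hcond, hpN, -⟩ :=
    ThreeFieldRoadSupply.exists_goodOrd_partner_rootNumber W p hmod hp5 hcell
  -- big image passes through the twist
  have hsurjV : Surj V p :=
    (surj_iff_of_model_twist V p (pStar_ne_zero p) ⟨C, hC⟩).mp hsurj
  -- conductor exponents of `V` away from `p` are those of `W`
  have hNV0 : V.conductorNorm ℤ ≠ 0 := (V.conductorNorm_pos_holds).ne'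
  have hfac : ∀ ℓ : ℕ, ℓ ≠ p → (V.conductorNorm ℤ).factorization ℓ = (W.conductorNorm ℤ).factorization ℓ := by
    intro ℓ hℓ
    rw [hcond, Nat.factorization_mul hNV0 (pow_ne_zero 2 hpr.ne_zero), Finsupp.add_apply,
      Nat.factorization_pow, Finsupp.smul_apply, hpr.factorization, Finsupp.single_apply, if_neg (Ne.symm hℓ)]
    simp
  have hfacle : ∀ ℓ : ℕ, (W.conductorNorm ℤ).factorization ℓ ≤ 1 ∨ ℓ = p := by
    intro ℓ
    by_cases hℓp : ℓ = p
    · exact Or.inr hℓp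
    by_cases hℓ : ℓ.Prime
    · left
      haveI : Fact ℓ.Prime := ⟨hℓ⟩
      rcases hss ℓ hℓ hℓp with hg | hm
      · rw [Nat.factorization_eq_zero_of_not_dvd (not_dvd_conductorNorm_of_hasGoodReductionAtPrime W hg)]
        exact zero_le_one
      · rw [W.factorization_conductorNorm_eq_one_of_hasMultiplicativeReductionAtPrime ℓ hm]
    · left
      rw [Nat.factorization_eq_zero_of_not_prime _ hℓ]
      exact zero_le_one
  -- `N_V` square-free
  have hsq : Squarefree (V.conductorNorm ℤ) := by
    rw [Nat.squarefree_iff_factorization_le_one hNV0]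
    intro ℓ
    by_cases hℓp : ℓ = p
    · rw [hℓp, Nat.factorization_eq_zero_of_not_dvd hpN]
      exact zero_le_one
    · rw [hfac ℓ hℓp]
      exact (hfacle ℓ).resolve_right hℓp
  -- `q ∥ N_V`
  have hfq : (V.conductorNorm ℤ).factorization q = 1 := by
    rw [hfac q hqp, W.factorization_conductorNorm_eq_one_of_hasMultiplicativeReductionAtPrime q hmq]
  have hqN : q ∣ V.conductorNorm ℤ :=
    (hqr.dvd_iff_one_le_factorization hNV0).mpr (by rw [hfq])
  -- the twist parameter `p* = 4k + 1` is prime to `q`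
  have hqd : ¬ (q : ℤ) ∣ (-1 : ℤ) ^ (p / 2) * p := fun h ↦
    hqp (AdditiveKoly.RamifiedHabitat.eq_of_prime_dvd_pStar (p := p) hqr h)
  have hd0 : ((-1 : ℤ) ^ (p / 2) * p) ≠ 0 := by
    refine mul_ne_zero (pow_ne_zero _ (by norm_num)) (by exact_mod_cast hpr.ne_zero)
  have hCint : C • V.quadraticTwist (((-1 : ℤ) ^ (p / 2) * p : ℤ) : ℚ) = W := by
    rw [ThreeFieldRoadSupply.pStar_cast]; exact hC
  -- `V` multiplicative at `q`
  haveI : (V.quadraticTwist (((-1 : ℤ) ^ (p / 2) * p : ℤ) : ℚ)).IsElliptic :=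
    V.isElliptic_quadraticTwist (by exact_mod_cast hd0)
  have hmV : V.HasMultiplicativeReductionAtPrime q := by
    have h1 : (V.quadraticTwist (((-1 : ℤ) ^ (p / 2) * p : ℤ) : ℚ)).HasMultiplicativeReductionAtPrime q := by
      rw [← hasMultiplicativeReductionAtPrime_smul_iff _ C q, hCint]; exact hmq
    exact (GenusGrossZagier.hasMultiplicativeReductionAtPrime_quadraticTwist_iff_of_odd V hq2 hd0 hqd).mp h1
  -- `v_q(Δ_min V) = v_q(Δ_min W)`
  have hk : ((-1 : ℤ) ^ (p / 2) * p) = 4 * (((-1 : ℤ) ^ (p / 2) * p - 1) / 4) + 1 := by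
    have h4 := AdditiveKoly.RamifiedHabitat.pStar_emod_four (p := p) hp2
    omega
  have hCk : C • V.quadraticTwist ((4 * (((-1 : ℤ) ^ (p / 2) * p - 1) / 4) + 1 : ℤ) : ℚ) = W := by
    rw [← hk]; exact hCint
  have hqd' : ¬ (q : ℤ) ∣ 4 * (((-1 : ℤ) ^ (p / 2) * p - 1) / 4) + 1 := by rw [← hk]; exact hqd
  have hval : padicValInt q W.minimalDiscriminantInt = padicValInt q V.minimalDiscriminantInt :=
    AdditiveKoly.RamifiedHabitat.padicValInt_minimalDiscriminantInt_eq_of_twist_of_not_dvd V hqd' C hCk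
  refine ⟨V, iV, iVm, C, hC, hord, hcond, hpN, hsq, hsurjV, hqN, hmV, ?_⟩
  rw [← hval]; exact hram

end Summit.BirchSwinnertonDyer.BirchSwinnertonDyer.Theorems.TamePartnerData

end
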